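import Literature.Probability.Process.BrownianNewtonSupermartingale
import HarnessLib

/-!
# The hitting masses of the Brownian loop measure at `0` in `ℝ⁴`: `loopBase{hit F} = E[𝟙{τ_F<∞} |W_{τ_F}|⁻²]`

Topic `Probability/Process`; small definitions with bodies (`pastEval`, `PastHitsBefore`,
`LoopHits`, `levelTime`, `levelSet`) and theorems, no named fact. This completes the probabilistic
description of the Brownian loop measure `loopBase` at `0` in `ℝ⁴` (`BrownianLoopDensity4`, the
four-dimensional lift of the Brownian bubble construction of Lawler–Schramm–Werner, *Conformal
restriction: the chordal case*, JAMS **16** (2003), §7.1 second bullet): for `F ⊆ ℝ⁴` closed and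
bounded with `v₀²+…+v₃² ≥ δ² > 0` on `F`,

* `loopBase_loopHits_eq` — **`loopBase {the loop hits F before its lifetime} =
  ∫⁻ 𝟙{τ_F < ∞} |W_{τ_F}|⁻² dℙ`**, `W = brownianQuad`, `τ_F = hitFrom W F 0`.

Proof. The event is the increasing union over generations `n` of the disjoint dyadic level sets
`B^n_k = {k2⁻ⁿ < T} ∩ {hit before k2⁻ⁿ} ∖ {hit before (k−1)2⁻ⁿ}` (`levelSet`;
`iUnion_levelSet_mono`, `iUnion_iUnion_levelSet_eq`). Each `B^n_k` is the lifetime condition times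
a measurable functional of the loop observed on `[0, k2⁻ⁿ]` — "hits `F` before `c`" is written
countably through rational times and distances (`PastHitsBefore`, `measurableSet_pastHitsBefore`),
which for continuous paths and closed `F` is genuine hitting (`pastHitsBefore_iff`) — so the
`h`-transform density `lintegral_loopBase_eq` gives
`loopBase (B^n_k) = E[𝟙{(k−1)2⁻ⁿ ≤ τ < k2⁻ⁿ} |W_{k2⁻ⁿ}|⁻²]` (`loopBase_levelSet`) and, summing,
`loopBase (⋃ₖ B^n_k) = E[𝟙{τ<∞} |W_{τ_n}|⁻²]` with `τ_n = dyadicCeil n τ`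
(`loopBase_iUnion_levelSet`, `tsum_level_indicator_eq`). These are `≤ E[𝟙{τ<∞}|W_τ|⁻²]` by the
supermartingale inequality `IsBrownianVec.lintegral_newtonR_dyadicCeil_le`
(`BrownianNewtonSupermartingale`), and `≥` it in the limit by Fatou (`τ_n → τ`, continuity of
paths and of `|·|⁻²` off `0`).

With `RandomPlanarGeometry/BubbleHittingMass` (`E[𝟙{τ_A<∞}|W_{τ_A}|⁻²] = −SΦ_A(0)/6` for the lifted
hull `exPt⁻¹ A`) this yields (7.2) of [LSW] for the image of `loopBase` in `ℍ`.

## References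

* G. F. Lawler, O. Schramm, W. Werner, *Conformal restriction: the chordal case*, J. Amer. Math.
  Soc. **16** (2003) 917–955, §7.1 (second bullet; (7.2)). [LawlerSchrammWerner2003Restriction]
* J.-F. Le Gall, *Brownian Motion, Martingales, and Stochastic Calculus* (2016), Ch. 7 §7.2.
  [Legall2016]
-/

noncomputable section


open MeasureTheory ProbabilityTheory Filter Topology Set Metric
open scoped NNReal ENNReal

namespace Literature.Probability.Process

/-! ### A countably described hitting functional of the past -/

/-- Evaluation of a past `q : [0, t] → ℝ⁴` at a time `x` (junk `0` for `x > t`). [folklore] -/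
def pastEval {d : ℕ} (t : ℝ≥0) (q : Set.Iic t → Fin d → ℝ) (x : ℝ≥0) : Fin d → ℝ :=
  if h : x ≤ t then q ⟨x, h⟩ else 0

/-- `pastEval` is measurable in the past, for each time. [folklore] -/
theorem measurable_pastEval {d : ℕ} (t x : ℝ≥0) : Measurable fun q : Set.Iic t → Fin d → ℝ ↦ pastEval t q x := by
  unfold pastEval
  by_cases h : x ≤ t
  · simp only [h, dite_true]; exact measurable_pi_apply _
  · simp only [h, dite_false]; exact measurable_const

/-- **"The past hits `F` strictly before `c`"**, described countably (rational times, distances):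
some rational `u ∈ [0, c)` such that for every `m` some rational `r ∈ [0, u]` has
`dist(q(r), F) < 1/(m+1)`. For a continuous path and a closed `F` this is `∃ s < c, q(s) ∈ F`
(`pastHitsBefore_iff`). [folklore] -/
def PastHitsBefore {d : ℕ} (t : ℝ≥0) (c : ℝ) (F : Set (Fin d → ℝ)) (q : Set.Iic t → Fin d → ℝ) : Prop :=
  ∃ u : ℚ, (0 : ℚ) ≤ u ∧ (u : ℝ) < c ∧
    ∀ m : ℕ, ∃ r : ℚ, 0 ≤ r ∧ r ≤ u ∧ infDist (pastEval t q (Real.toNNReal r)) F < 1 / ((m : ℝ) + 1)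

/-- The hitting functional is a measurable event of the past. [folklore] -/
theorem measurableSet_pastHitsBefore {d : ℕ} (t : ℝ≥0) (c : ℝ) (F : Set (Fin d → ℝ)) :
    MeasurableSet {q : Set.Iic t → Fin d → ℝ | PastHitsBefore t c F q} := by
  have h1 : ∀ (x : ℝ≥0) (a : ℝ), MeasurableSet {q : Set.Iic t → Fin d → ℝ | infDist (pastEval t q x) F < a} :=
    fun x a ↦ measurableSet_lt ((continuous_infDist_pt F).measurable.comp (measurable_pastEval t x)) measurable_const
  have : {q : Set.Iic t → Fin d → ℝ | PastHitsBefore t c F q} =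
      ⋃ u : {u : ℚ // (0 : ℚ) ≤ u ∧ (u : ℝ) < c}, ⋂ m : ℕ, ⋃ r : {r : ℚ // 0 ≤ r ∧ r ≤ u.1},
        {q | infDist (pastEval t q (Real.toNNReal r.1)) F < 1 / ((m : ℝ) + 1)} := by
    ext q
    simp only [PastHitsBefore, mem_setOf_eq, mem_iUnion, mem_iInter, Subtype.exists, exists_prop]
    constructor
    · rintro ⟨u, hu0, huc, h⟩
      exact ⟨u, ⟨hu0, huc⟩, fun m ↦ by obtain ⟨r, hr0, hru, hr⟩ := h m; exact ⟨r, ⟨hr0, hru⟩, hr⟩⟩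
    · rintro ⟨u, ⟨hu0, huc⟩, h⟩
      exact ⟨u, hu0, huc, fun m ↦ by obtain ⟨r, ⟨hr0, hru⟩, hr⟩ := h m; exact ⟨r, hr0, hru, hr⟩⟩
  rw [this]
  exact MeasurableSet.iUnion fun u ↦ MeasurableSet.iInter fun m ↦ MeasurableSet.iUnion fun r ↦ h1 _ _

/-- **For a continuous path and a closed nonempty `F`, the countable functional is hitting before
`c`** (`c ≤ t`): `PastHitsBefore t c F (γ|[0,t]) ↔ ∃ s < c, γ(s) ∈ F` (density of the rationals and
continuity for `⇐`; compactness of `[0, u]` and closedness of `F` for `⇒`). [folklore] -/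
theorem pastHitsBefore_iff {d : ℕ} {t : ℝ≥0} {c : ℝ} (hct : c ≤ t) {F : Set (Fin d → ℝ)} (hF : IsClosed F)
    (hne : F.Nonempty) {γ : ℝ≥0 → Fin d → ℝ} (hγ : Continuous γ) :
    PastHitsBefore t c F (fun s : Set.Iic t ↦ γ s) ↔ ∃ s : ℝ≥0, (s : ℝ) < c ∧ γ s ∈ F := by
  have hev : ∀ x : ℝ≥0, x ≤ t → pastEval t (fun s : Set.Iic t ↦ γ s) x = γ x := fun x hx ↦ by
    simp [pastEval, hx]
  constructor
  · rintro ⟨u, hu0, huc, h⟩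
    have hut : ((u : ℝ).toNNReal : ℝ) ≤ t := by
      rw [Real.coe_toNNReal _ (by exact_mod_cast hu0)]; exact huc.le.trans hct
    choose r hr0 hru hr using h
    set x : ℕ → ℝ≥0 := fun m ↦ ((r m : ℝ)).toNNReal with hx
    have hxle : ∀ m, x m ≤ (u : ℝ).toNNReal := fun m ↦ Real.toNNReal_le_toNNReal (by exact_mod_cast hru m)
    have hxt : ∀ m, x m ≤ t := fun m ↦ by
      have := hxle m
      have h2 : (((u : ℝ).toNNReal : ℝ≥0) : ℝ) ≤ t := hut
      exact_mod_cast (show (x m : ℝ) ≤ t from (NNReal.coe_le_coe.2 this).trans h2)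
    obtain ⟨a, ha, φ, hφ, hlim⟩ := (isCompact_Icc (a := (0 : ℝ≥0)) (b := (u : ℝ).toNNReal)).tendsto_subseq
      (x := x) fun m ↦ ⟨bot_le, hxle m⟩
    refine ⟨a, ?_, ?_⟩
    · have : (a : ℝ) ≤ u := by
        have h1 : a ≤ (u : ℝ).toNNReal := ha.2
        have h2 : (((u : ℝ).toNNReal : ℝ≥0) : ℝ) = u := Real.coe_toNNReal _ (by exact_mod_cast hu0)
        rw [← h2]; exact_mod_cast h1
      exact this.trans_lt huc
    · have hcont : Continuous fun s ↦ infDist (γ s) F := (continuous_infDist_pt F).comp hγ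
      have h1 : Tendsto (fun m ↦ infDist (γ (x (φ m))) F) atTop (𝓝 (infDist (γ a) F)) :=
        (hcont.tendsto a).comp hlim
      have h2 : Tendsto (fun m ↦ infDist (γ (x (φ m))) F) atTop (𝓝 0) := by
        refine squeeze_zero (g := fun m ↦ 1 / ((φ m : ℝ) + 1)) (fun m ↦ infDist_nonneg) (fun m ↦ ?_) ?_
        · have := hr (φ m)
          rw [hev _ (hxt (φ m))] at this
          exact this.le
        · exact tendsto_one_div_add_atTop_nhds_zero_nat.comp hφ.tendsto_atTop
      have h0 : infDist (γ a) F = 0 := tendsto_nhds_unique h1 h2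
      exact (hF.mem_iff_infDist_zero hne).2 h0
  · rintro ⟨s, hsc, hsF⟩
    obtain ⟨u, hsu, huc⟩ := exists_rat_btwn hsc
    have hu0 : (0 : ℚ) ≤ u := by
      have : (0 : ℝ) ≤ u := (s.coe_nonneg).trans hsu.le
      exact_mod_cast this
    refine ⟨u, hu0, huc, fun m ↦ ?_⟩
    -- continuity of `infDist (γ ·) F` at `s`, where it vanishes
    have hcont : Continuous fun x : ℝ≥0 ↦ infDist (γ x) F := (continuous_infDist_pt F).comp hγ
    have h0 : infDist (γ s) F = 0 := infDist_zero_of_mem hsF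
    have hpos : (0 : ℝ) < 1 / ((m : ℝ) + 1) := by positivity
    obtain ⟨ε, hε, hball⟩ : ∃ ε > 0, ∀ x : ℝ≥0, dist x s < ε → infDist (γ x) F < 1 / ((m : ℝ) + 1) := by
      have := Metric.tendsto_nhds.1 (hcont.tendsto s) (1 / ((m : ℝ) + 1)) hpos
      rw [h0] at this
      obtain ⟨ε, hε, h⟩ := Metric.eventually_nhds_iff.1 this
      exact ⟨ε, hε, fun x hx ↦ by have := h hx; rwa [Real.dist_eq, sub_zero, abs_of_nonneg infDist_nonneg] at this⟩
    -- a rational `r ∈ [0, s]`, `ε`-close to `s`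
    obtain ⟨r, hr0, hrs, hrε⟩ : ∃ r : ℚ, (0 : ℚ) ≤ r ∧ (r : ℝ) ≤ s ∧ (s : ℝ) - r < ε := by
      by_cases hs0 : (s : ℝ) < ε
      · exact ⟨0, le_rfl, by exact_mod_cast s.coe_nonneg, by push_cast; linarith⟩
      · push Not at hs0
        obtain ⟨r, hr1, hr2⟩ := exists_rat_btwn (show (s : ℝ) - ε < s by linarith)
        refine ⟨r, ?_, hr2.le, by linarith⟩
        have : (0 : ℝ) ≤ r := by linarith
        exact_mod_cast this
    refine ⟨r, hr0, ?_, ?_⟩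
    · have : (r : ℝ) ≤ u := hrs.trans hsu.le
      exact_mod_cast this
    · have hrt : ((r : ℝ)).toNNReal ≤ t := by
        have h1 : ((r : ℝ)).toNNReal ≤ s := by
          rw [← Real.toNNReal_coe (r := s)]; exact Real.toNNReal_le_toNNReal hrs
        exact h1.trans (by have : (s : ℝ) ≤ t := hsc.le.trans hct; exact_mod_cast this)
      rw [hev _ hrt]
      apply hball
      rw [NNReal.dist_eq, Real.coe_toNNReal _ (by exact_mod_cast hr0), abs_sub_comm, abs_of_nonneg (by linarith)]
      exact hrε

end Literature.Probability.Process


namespace Literature.Probability.Process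

open Literature.Probability.RandomPlanarGeometry IsBrownianVec

/-! ### The loop hits `F` before time `c`; the dyadic level sets -/

/-- **The Brownian loop of duration `T` hits `F` strictly before time `c`.** [folklore] -/
def LoopHits (F : Set (Fin 4 → ℝ)) (p : ℝ × WienerQuad) (c : ℝ) : Prop :=
  ∃ s : ℝ≥0, (s : ℝ) < c ∧ quadLoop p.1 p.2 s ∈ F

/-- `LoopHits` is monotone in the time bound. [folklore] -/
theorem LoopHits.mono {F : Set (Fin 4 → ℝ)} {p : ℝ × WienerQuad} {c c' : ℝ} (h : LoopHits F p c) (hcc' : c ≤ c') :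
    LoopHits F p c' := by
  obtain ⟨s, hs, hsF⟩ := h; exact ⟨s, hs.trans_le hcc', hsF⟩

/-- No hit before time `0`. [folklore] -/
theorem not_loopHits_zero (F : Set (Fin 4 → ℝ)) (p : ℝ × WienerQuad) : ¬ LoopHits F p 0 := by
  rintro ⟨s, hs, -⟩; exact absurd hs (not_lt.2 s.coe_nonneg)

/-- Every loop path is continuous in time. [folklore] -/
theorem continuous_quadLoop (T : ℝ) (ω : WienerQuad) : Continuous (quadLoop T ω) := by
  unfold quadLoop
  refine (isBrownianVec_brownianQuad.continuous_path ω).sub ?_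
  exact ((NNReal.continuous_coe.div_const T).smul continuous_const)

/-- The dyadic grid `t^n_k = k 2⁻ⁿ`. [folklore] -/
def levelTime (n k : ℕ) : ℝ≥0 := ((k : ℕ) : ℝ≥0) / 2 ^ n

/-- `t^n_0 = 0`. [folklore] -/
@[simp] theorem levelTime_zero (n : ℕ) : levelTime n 0 = 0 := by simp [levelTime]

/-- The grid is monotone in `k`. [folklore] -/
theorem levelTime_mono (n : ℕ) {k l : ℕ} (h : k ≤ l) : levelTime n k ≤ levelTime n l := by
  unfold levelTime; gcongr

/-- `t^n_k = t^{n+1}_{2k}`. [folklore] -/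
theorem levelTime_succ (n k : ℕ) : levelTime (n + 1) (2 * k) = levelTime n k := by
  unfold levelTime
  rw [pow_succ]
  push_cast
  field_simp

/-- `dyadicCeil n r` is the grid point `t^n_{⌊2ⁿ r⌋ + 1}`. [folklore] -/
theorem dyadicCeil_eq_levelTime (n : ℕ) (r : ℝ≥0) : dyadicCeil n r = levelTime n (⌊r * (2 : ℝ≥0) ^ n⌋₊ + 1) := rfl

/-- `t^n_{k-1} ≤ r < t^n_k` forces `k = ⌊2ⁿ r⌋ + 1`. [folklore] -/
theorem eq_floor_add_one_of_mem {n k : ℕ} {r : ℝ≥0} (h1 : levelTime n (k - 1) ≤ r) (h2 : r < levelTime n k) :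
    k = ⌊r * (2 : ℝ≥0) ^ n⌋₊ + 1 := by
  have hk : 1 ≤ k := by
    rcases Nat.eq_zero_or_pos k with rfl | hk
    · simp [levelTime] at h2
    · exact hk
  unfold levelTime at h1 h2
  rw [div_le_iff₀ (by positivity)] at h1
  rw [lt_div_iff₀ (by positivity)] at h2
  have h3 : ⌊r * (2 : ℝ≥0) ^ n⌋₊ = k - 1 := by
    rw [Nat.floor_eq_iff (by positivity)]
    constructor
    · exact_mod_cast h1
    · have : ((k - 1 : ℕ) : ℝ≥0) + 1 = k := by exact_mod_cast Nat.sub_add_cancel hk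
      rw [this]; exact_mod_cast h2
  omega

/-- The grid point just after `r` satisfies `t^n_{k-1} ≤ r < t^n_k`, `k = ⌊2ⁿr⌋ + 1`. [folklore] -/
theorem levelTime_floor_le_lt (n : ℕ) (r : ℝ≥0) :
    levelTime n (⌊r * (2 : ℝ≥0) ^ n⌋₊ + 1 - 1) ≤ r ∧ r < levelTime n (⌊r * (2 : ℝ≥0) ^ n⌋₊ + 1) := by
  refine ⟨?_, by rw [← dyadicCeil_eq_levelTime]; exact lt_dyadicCeil n r⟩
  simp only [Nat.add_sub_cancel, levelTime]
  rw [div_le_iff₀ (by positivity)]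
  exact Nat.floor_le (by positivity)

/-- **The dyadic level set** `B^n_k = {t^n_k < T} ∩ {hit before t^n_k} ∖ {hit before t^n_{k-1}}`
(`k ≥ 1`; empty for `k = 0`). [folklore] -/
def levelSet (F : Set (Fin 4 → ℝ)) (n k : ℕ) : Set (ℝ × WienerQuad) :=
  {p | (levelTime n k : ℝ) < p.1 ∧ LoopHits F p (levelTime n k) ∧ ¬ LoopHits F p (levelTime n (k - 1))}

variable {F : Set (Fin 4 → ℝ)}

/-- The level set as a preimage of the countable past functional (continuous loop paths). [folklore] -/
theorem levelSet_eq_preimage (hF : IsClosed F) (hne : F.Nonempty) (n k : ℕ) :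
    levelSet F n k = {p : ℝ × WienerQuad | (levelTime n k : ℝ) < p.1} ∩ quadLoopPast (levelTime n k) ⁻¹'
      {q | PastHitsBefore (levelTime n k) (levelTime n k) F q ∧
        ¬ PastHitsBefore (levelTime n k) (levelTime n (k - 1)) F q} := by
  ext p
  simp only [levelSet, mem_setOf_eq, mem_inter_iff, mem_preimage]
  have h1 : PastHitsBefore (levelTime n k) (levelTime n k) F (quadLoopPast (levelTime n k) p) ↔
      LoopHits F p (levelTime n k) :=
    pastHitsBefore_iff le_rfl hF hne (continuous_quadLoop p.1 p.2)
  have h2 : PastHitsBefore (levelTime n k) (levelTime n (k - 1)) F (quadLoopPast (levelTime n k) p) ↔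
      LoopHits F p (levelTime n (k - 1)) :=
    pastHitsBefore_iff (by exact_mod_cast levelTime_mono n (Nat.sub_le k 1)) hF hne (continuous_quadLoop p.1 p.2)
  rw [h1, h2]

/-- The level sets are measurable. [folklore] -/
theorem measurableSet_levelSet (hF : IsClosed F) (hne : F.Nonempty) (n k : ℕ) : MeasurableSet (levelSet F n k) := by
  rw [levelSet_eq_preimage hF hne]
  exact (measurableSet_lt measurable_const measurable_fst).inter
    ((measurable_quadLoopPast _) ((measurableSet_pastHitsBefore _ _ _).inter (measurableSet_pastHitsBefore _ _ _).compl))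

/-- `τ < c` iff `F` is visited at a time `< c` (hitting from `0`, closed `F`). [folklore] -/
theorem hitFrom_lt_coe_iff {Ω : Type*} {mΩ : MeasurableSpace Ω} {P : Measure Ω} {d : ℕ}
    {W' : ℝ≥0 → Ω → (Fin d → ℝ)} (hW : IsBrownianVec W' P) {G : Set (Fin d → ℝ)} (hG : IsClosed G)
    {ω : Ω} {c : ℝ≥0} : hitFrom W' G 0 ω < c ↔ ∃ s : ℝ≥0, s < c ∧ W' s ω ∈ G := by
  constructor
  · intro h
    obtain ⟨T, hT⟩ := WithTop.ne_top_iff_exists.1 (ne_top_of_lt h)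
    refine ⟨T, ?_, hW.mem_of_hitFrom_eq_coe hG hT.symm⟩
    rw [← hT] at h; exact_mod_cast h
  · rintro ⟨s, hs, hsG⟩
    exact (hitFrom_le_of_mem bot_le hsG).trans_lt (by exact_mod_cast hs)

/-- **The level identity** (the `h`-transform density `lintegral_loopBase_eq` applied to the
hitting functional of the past): for `k ≥ 1`,
`loopBase (B^n_k) = E[𝟙{t^n_{k-1} ≤ τ < t^n_k} |W_{t^n_k}|⁻²]`, `τ` the hitting time of `F` by
`W = brownianQuad`. [folklore] -/
theorem loopBase_levelSet (hF : IsClosed F) (hne : F.Nonempty) (n : ℕ) {k : ℕ} (hk : 1 ≤ k) :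
    loopBase (levelSet F n k) = ∫⁻ ω, {ω | ((levelTime n (k - 1) : ℝ≥0) : WithTop ℝ≥0) ≤ hitFrom brownianQuad F 0 ω ∧
        hitFrom brownianQuad F 0 ω < ((levelTime n k : ℝ≥0) : WithTop ℝ≥0)}.indicator
      (fun ω ↦ newtonFour (brownianQuad (levelTime n k) ω)) ω ∂wienerQuad := by
  have hW := isBrownianVec_brownianQuad
  set t := levelTime n k with htdef
  have ht : 0 < t := by
    simp only [htdef, levelTime]
    exact div_pos (by exact_mod_cast hk) (by positivity)
  set G : Set (Set.Iic t → Fin 4 → ℝ) := {q | PastHitsBefore t t F q ∧ ¬ PastHitsBefore t (levelTime n (k - 1)) F q}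
    with hGdef
  have hGm : MeasurableSet G := (measurableSet_pastHitsBefore _ _ _).inter (measurableSet_pastHitsBefore _ _ _).compl
  have key := lintegral_loopBase_eq ht (F := G.indicator fun _ ↦ (1 : ℝ≥0∞)) (measurable_const.indicator hGm)
  -- left-hand side: the measure of the level set
  have hL : ∫⁻ p, (Ioi (t : ℝ)).indicator (fun _ ↦ (1 : ℝ≥0∞)) p.1 * G.indicator (fun _ ↦ (1 : ℝ≥0∞))
      (quadLoopPast t p) ∂loopBase = loopBase (levelSet F n k) := by
    rw [← lintegral_indicator_one (measurableSet_levelSet hF hne n k)]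
    refine lintegral_congr fun p ↦ ?_
    rw [levelSet_eq_preimage hF hne]
    by_cases h1 : (t : ℝ) < p.1
    · by_cases h2 : quadLoopPast t p ∈ G
      · rw [indicator_of_mem (show p.1 ∈ Ioi (t : ℝ) from h1), indicator_of_mem h2,
          indicator_of_mem (show p ∈ {p : ℝ × WienerQuad | (levelTime n k : ℝ) < p.1} ∩ quadLoopPast (levelTime n k) ⁻¹'
            {q | PastHitsBefore (levelTime n k) (levelTime n k) F q ∧
              ¬ PastHitsBefore (levelTime n k) (levelTime n (k - 1)) F q} from ⟨h1, h2⟩), one_mul, Pi.one_apply]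
      · rw [indicator_of_notMem h2, mul_zero, indicator_of_notMem]
        exact fun h ↦ h2 h.2
    · rw [indicator_of_notMem (show p.1 ∉ Ioi (t : ℝ) from h1), zero_mul, indicator_of_notMem]
      exact fun h ↦ h1 h.1
  -- right-hand side: the hitting event of `W`
  have hR : ∫⁻ ω, G.indicator (fun _ ↦ (1 : ℝ≥0∞)) (vecPast brownianQuad t ω) * newtonFour (brownianQuad t ω) ∂wienerQuad =
      ∫⁻ ω, {ω | ((levelTime n (k - 1) : ℝ≥0) : WithTop ℝ≥0) ≤ hitFrom brownianQuad F 0 ω ∧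
        hitFrom brownianQuad F 0 ω < ((t : ℝ≥0) : WithTop ℝ≥0)}.indicator
      (fun ω ↦ newtonFour (brownianQuad t ω)) ω ∂wienerQuad := by
    refine lintegral_congr fun ω ↦ ?_
    have hpath : vecPast brownianQuad t ω = fun s : Set.Iic t ↦ brownianQuad s ω := rfl
    have hc : Continuous fun s : ℝ≥0 ↦ brownianQuad s ω := hW.continuous_path ω
    have h1 : PastHitsBefore t t F (vecPast brownianQuad t ω) ↔ hitFrom brownianQuad F 0 ω < ((t : ℝ≥0) : WithTop ℝ≥0) := by
      rw [hpath, pastHitsBefore_iff le_rfl hF hne hc, hitFrom_lt_coe_iff hW hF]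
      simp only [NNReal.coe_lt_coe]
    have h2 : PastHitsBefore t (levelTime n (k - 1)) F (vecPast brownianQuad t ω) ↔
        hitFrom brownianQuad F 0 ω < ((levelTime n (k - 1) : ℝ≥0) : WithTop ℝ≥0) := by
      rw [hpath, pastHitsBefore_iff (by exact_mod_cast levelTime_mono n (Nat.sub_le k 1)) hF hne hc,
        hitFrom_lt_coe_iff hW hF]
      simp only [NNReal.coe_lt_coe]
    by_cases hmem : vecPast brownianQuad t ω ∈ G
    · rw [indicator_of_mem hmem, one_mul, indicator_of_mem]
      exact ⟨not_lt.1 (h2.not.1 hmem.2), h1.1 hmem.1⟩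
    · rw [indicator_of_notMem hmem, zero_mul, indicator_of_notMem]
      rintro ⟨ha, hb⟩
      exact hmem ⟨h1.2 hb, h2.not.2 (not_lt.2 ha)⟩
  rw [← hL, key, hR]

end Literature.Probability.Process


namespace Literature.Probability.Process

open Literature.Probability.RandomPlanarGeometry IsBrownianVec

variable {F : Set (Fin 4 → ℝ)}

/-! ### Summing the levels: `loopBase (⋃ₖ B^n_k) = E[𝟙{τ<∞} |W_{τ_n}|⁻²]` -/

/-- The `W`-side level indicators sum to `𝟙{τ < ∞} |W_{τ_n}|⁻²`, `τ_n = dyadicCeil n τ`. [folklore] -/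
theorem tsum_level_indicator_eq (n : ℕ) (ω : WienerQuad) :
    ∑' k : ℕ, {ω | ((levelTime n (k - 1) : ℝ≥0) : WithTop ℝ≥0) ≤ hitFrom brownianQuad F 0 ω ∧
        hitFrom brownianQuad F 0 ω < ((levelTime n k : ℝ≥0) : WithTop ℝ≥0)}.indicator
      (fun ω ↦ newtonFour (brownianQuad (levelTime n k) ω)) ω =
    {ω | hitFrom brownianQuad F 0 ω ≠ ⊤}.indicator
      (fun ω ↦ ENNReal.ofReal (newtonR (brownianQuad (dyadicCeil n (hitFrom brownianQuad F 0 ω).untopA) ω))) ω := by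
  set τ := hitFrom brownianQuad F 0 with hτ
  by_cases hT : τ ω = ⊤
  · rw [indicator_of_notMem (show ω ∉ {ω | τ ω ≠ ⊤} from fun h ↦ h hT)]
    refine ENNReal.tsum_eq_zero.2 fun k ↦ ?_
    rw [indicator_of_notMem]
    rintro ⟨-, h2⟩
    rw [hT] at h2
    exact absurd h2 (not_lt.2 le_top)
  · obtain ⟨T₀, hT₀⟩ := WithTop.ne_top_iff_exists.1 hT
    rw [indicator_of_mem (show ω ∈ {ω | τ ω ≠ ⊤} from hT)]
    have huT : (τ ω).untopA = T₀ := by rw [← hT₀]; rfl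
    rw [huT]
    rw [tsum_eq_single (⌊T₀ * (2 : ℝ≥0) ^ n⌋₊ + 1)]
    · obtain ⟨h1, h2⟩ := levelTime_floor_le_lt n T₀
      rw [indicator_of_mem]
      · rw [← dyadicCeil_eq_levelTime, newtonFour, newtonR, one_div]
      · refine ⟨?_, ?_⟩
        · show ((levelTime n (⌊T₀ * (2 : ℝ≥0) ^ n⌋₊ + 1 - 1) : ℝ≥0) : WithTop ℝ≥0) ≤ τ ω
          rw [← hT₀]; exact_mod_cast h1
        · show τ ω < ((levelTime n (⌊T₀ * (2 : ℝ≥0) ^ n⌋₊ + 1) : ℝ≥0) : WithTop ℝ≥0)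
          rw [← hT₀]; exact_mod_cast h2
    · intro k hk
      rw [indicator_of_notMem]
      rintro ⟨h1, h2⟩
      have h1' : levelTime n (k - 1) ≤ T₀ := by
        have : ((levelTime n (k - 1) : ℝ≥0) : WithTop ℝ≥0) ≤ T₀ := by rw [hT₀]; exact h1
        exact_mod_cast this
      have h2' : T₀ < levelTime n k := by
        have : (T₀ : WithTop ℝ≥0) < ((levelTime n k : ℝ≥0) : WithTop ℝ≥0) := by rw [hT₀]; exact h2
        exact_mod_cast this
      exact hk (eq_floor_add_one_of_mem h1' h2')

/-- The level sets of one generation are pairwise disjoint. [folklore] -/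
theorem pairwise_disjoint_levelSet (F : Set (Fin 4 → ℝ)) (n : ℕ) : Pairwise (Function.onFun Disjoint (levelSet F n)) := by
  intro k l hkl
  wlog h : k < l generalizing k l
  · exact (this hkl.symm (lt_of_le_of_ne (not_lt.1 h) hkl.symm)).symm
  refine Set.disjoint_left.2 fun p hk hl ↦ ?_
  have h1 : LoopHits F p (levelTime n k) := hk.2.1
  have h2 : ¬ LoopHits F p (levelTime n (l - 1)) := hl.2.2
  exact h2 (h1.mono (by exact_mod_cast levelTime_mono n (Nat.le_sub_one_of_lt h)))

/-- `B^n_0 = ∅`. [folklore] -/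
theorem levelSet_zero (F : Set (Fin 4 → ℝ)) (n : ℕ) : levelSet F n 0 = ∅ := by
  ext p
  simp only [levelSet, levelTime_zero, mem_setOf_eq, mem_empty_iff_false, iff_false, not_and]
  intro _ h
  exact absurd h (by exact_mod_cast not_loopHits_zero F p)

/-- The `W`-side level indicators are measurable (hitting events of a stopping time). [folklore] -/
theorem measurable_level_indicator (hF : IsClosed F) (n k : ℕ) :
    Measurable fun ω ↦ {ω | ((levelTime n (k - 1) : ℝ≥0) : WithTop ℝ≥0) ≤ hitFrom brownianQuad F 0 ω ∧
      hitFrom brownianQuad F 0 ω < ((levelTime n k : ℝ≥0) : WithTop ℝ≥0)}.indicator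
      (fun ω ↦ newtonFour (brownianQuad (levelTime n k) ω)) ω := by
  have hW := isBrownianVec_brownianQuad
  have hτ : IsStoppingTime hW.natFiltration (hitFrom brownianQuad F 0) := hW.isStoppingTime_hitFrom hF 0
  refine (measurable_newtonFour.comp (measurable_brownianQuad _)).indicator ?_
  have h1 : MeasurableSet {ω | hitFrom brownianQuad F 0 ω < ((levelTime n k : ℝ≥0) : WithTop ℝ≥0)} :=
    hτ.measurableSpace_le _ (hτ.measurableSet_lt' _)
  have h2 : MeasurableSet {ω | hitFrom brownianQuad F 0 ω < ((levelTime n (k - 1) : ℝ≥0) : WithTop ℝ≥0)} :=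
    hτ.measurableSpace_le _ (hτ.measurableSet_lt' _)
  have : {ω | ((levelTime n (k - 1) : ℝ≥0) : WithTop ℝ≥0) ≤ hitFrom brownianQuad F 0 ω ∧
      hitFrom brownianQuad F 0 ω < ((levelTime n k : ℝ≥0) : WithTop ℝ≥0)} =
      {ω | hitFrom brownianQuad F 0 ω < ((levelTime n (k - 1) : ℝ≥0) : WithTop ℝ≥0)}ᶜ ∩
      {ω | hitFrom brownianQuad F 0 ω < ((levelTime n k : ℝ≥0) : WithTop ℝ≥0)} := by
    ext ω; simp only [mem_setOf_eq, mem_inter_iff, mem_compl_iff, not_lt]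
  rw [this]
  exact h2.compl.inter h1

/-- **Generation `n`: `loopBase (⋃ₖ B^n_k) = E[𝟙{τ < ∞} |W_{τ_n}|⁻²]`.** [folklore] -/
theorem loopBase_iUnion_levelSet (hF : IsClosed F) (hne : F.Nonempty) (n : ℕ) :
    loopBase (⋃ k, levelSet F n k) = ∫⁻ ω, {ω | hitFrom brownianQuad F 0 ω ≠ ⊤}.indicator
      (fun ω ↦ ENNReal.ofReal (newtonR (brownianQuad (dyadicCeil n (hitFrom brownianQuad F 0 ω).untopA) ω))) ω
        ∂wienerQuad := by
  have hW := isBrownianVec_brownianQuad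
  have hτ : IsStoppingTime hW.natFiltration (hitFrom brownianQuad F 0) := hW.isStoppingTime_hitFrom hF 0
  rw [measure_iUnion (pairwise_disjoint_levelSet F n) (measurableSet_levelSet hF hne n)]
  have hind := measurable_level_indicator hF n
  rw [← lintegral_congr (fun ω ↦ tsum_level_indicator_eq (F := F) n ω), lintegral_tsum fun k ↦ (hind k).aemeasurable]
  refine tsum_congr fun k ↦ ?_
  rcases Nat.eq_zero_or_pos k with rfl | hk
  · rw [levelSet_zero, measure_empty]
    symm
    refine (lintegral_eq_zero_iff (hind 0)).2 (ae_of_all _ fun ω ↦ ?_)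
    simp only [Pi.zero_apply]
    rw [indicator_of_notMem]
    rintro ⟨-, h2⟩
    simp [levelTime] at h2
  · exact loopBase_levelSet hF hne n hk

/-! ### The generations increase to the hitting event -/

/-- The generation-`n` event, described by the minimal level. [folklore] -/
theorem iUnion_levelSet_eq (F : Set (Fin 4 → ℝ)) (n : ℕ) :
    (⋃ k, levelSet F n k) = {p | ∃ k, (levelTime n k : ℝ) < p.1 ∧ LoopHits F p (levelTime n k)} := by
  classical
  ext p
  simp only [mem_iUnion, levelSet, mem_setOf_eq]
  constructor
  · rintro ⟨k, h1, h2, -⟩; exact ⟨k, h1, h2⟩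
  · rintro ⟨k, h1, h2⟩
    have hex : ∃ j, LoopHits F p (levelTime n j) := ⟨k, h2⟩
    set k' := Nat.find hex with hk'
    have hk'P : LoopHits F p (levelTime n k') := Nat.find_spec hex
    have hk'le : k' ≤ k := Nat.find_min' hex h2
    have hk'0 : k' ≠ 0 := by
      intro h0
      rw [h0, levelTime_zero] at hk'P
      exact not_loopHits_zero F p (by exact_mod_cast hk'P)
    refine ⟨k', ?_, hk'P, ?_⟩
    · exact lt_of_le_of_lt (by exact_mod_cast levelTime_mono n hk'le) h1
    · exact Nat.find_min hex (Nat.sub_one_lt hk'0)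

/-- The generations increase. [folklore] -/
theorem iUnion_levelSet_mono (F : Set (Fin 4 → ℝ)) : Monotone fun n ↦ ⋃ k, levelSet F n k := by
  refine monotone_nat_of_le_succ fun n ↦ ?_
  rw [iUnion_levelSet_eq, iUnion_levelSet_eq]
  rintro p ⟨k, h1, h2⟩
  refine ⟨2 * k, ?_, ?_⟩ <;> rw [levelTime_succ]
  exacts [h1, h2]

/-- The generations exhaust `{the loop hits F before its lifetime}`. [folklore] -/
theorem iUnion_iUnion_levelSet_eq (F : Set (Fin 4 → ℝ)) :
    (⋃ n, ⋃ k, levelSet F n k) = {p : ℝ × WienerQuad | LoopHits F p p.1} := by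
  ext p
  simp only [mem_iUnion, mem_setOf_eq]
  constructor
  · rintro ⟨n, hp⟩
    have hp' : p ∈ ⋃ k, levelSet F n k := mem_iUnion.2 hp
    rw [iUnion_levelSet_eq] at hp'
    obtain ⟨k, h1, h2⟩ := hp'
    exact h2.mono h1.le
  · rintro ⟨s, hs, hsF⟩
    -- a generation with mesh `< T - s`
    obtain ⟨n, hn⟩ : ∃ n : ℕ, (1 : ℝ) / 2 ^ n < p.1 - s := by
      obtain ⟨n, hn⟩ := exists_pow_lt_of_lt_one (sub_pos.2 hs) (by norm_num : (1 : ℝ) / 2 < 1)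
      exact ⟨n, by rwa [div_pow, one_pow] at hn⟩
    set k := ⌊s * (2 : ℝ≥0) ^ n⌋₊ + 1 with hk
    have hmem : p ∈ ⋃ k, levelSet F n k := by
      rw [iUnion_levelSet_eq]
      refine ⟨k, ?_, s, ?_, hsF⟩
      · have h1 : levelTime n k ≤ s + 1 / 2 ^ n := by
          rw [hk, ← dyadicCeil_eq_levelTime]; exact dyadicCeil_le n s
        have h2 : ((levelTime n k : ℝ≥0) : ℝ) ≤ s + 1 / 2 ^ n := by exact_mod_cast h1
        linarith
      · have : s < levelTime n k := by rw [hk, ← dyadicCeil_eq_levelTime]; exact lt_dyadicCeil n s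
        exact_mod_cast this
    exact ⟨n, mem_iUnion.1 hmem⟩

/-! ### The hitting masses of the Brownian loop measure at `0` in `ℝ⁴` -/

/-- **The hitting identity for the Brownian loop measure at `0` in `ℝ⁴`.** For `F ⊆ ℝ⁴` closed,
bounded, with `sqSum ≥ δ² > 0` on `F`:

  `loopBase {the loop hits F before its lifetime} = E[𝟙{τ_F < ∞} |W_{τ_F}|⁻²]`,

`W = brownianQuad`, `τ_F = hitFrom W F 0`. The generations `⋃ₖ B^n_k` increase to the event; by the
`h`-transform density (`loopBase_levelSet`) their masses are `E[𝟙{τ<∞}|W_{τ_n}|⁻²]`, which are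
`≤ E[𝟙{τ<∞}|W_τ|⁻²]` (the supermartingale inequality `lintegral_newtonR_dyadicCeil_le`) and have
it as the limit inferior bound (Fatou, `τ_n ↓ τ`, continuity of paths).
[cite: LawlerSchrammWerner2003Restriction, §7.1 (second bullet, p. 28)] -/
theorem loopBase_loopHits_eq (hF : IsClosed F) (hFb : Bornology.IsBounded F) {δ : ℝ} (hδ : 0 < δ)
    (hFδ : ∀ v ∈ F, δ ^ 2 ≤ sqSum v) :
    loopBase {p : ℝ × WienerQuad | LoopHits F p p.1} =
      ∫⁻ ω, {ω | hitFrom brownianQuad F 0 ω ≠ ⊤}.indicator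
        (fun ω ↦ ENNReal.ofReal (newtonR (brownianQuad (hitFrom brownianQuad F 0 ω).untopA ω))) ω ∂wienerQuad := by
  have hW := isBrownianVec_brownianQuad
  rcases F.eq_empty_or_nonempty with rfl | hne
  · have h1 : {p : ℝ × WienerQuad | LoopHits ∅ p p.1} = ∅ := by
      ext p; simp only [mem_setOf_eq, mem_empty_iff_false, iff_false]
      rintro ⟨s, -, hs⟩; exact hs
    rw [h1, measure_empty]
    symm
    rw [← lintegral_zero (μ := wienerQuad)]
    refine lintegral_congr fun ω ↦ ?_
    rw [indicator_of_notMem]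
    intro h
    obtain ⟨j, -, hj⟩ := hitFrom_ne_top_iff.1 h
    exact hj
  · set τ := hitFrom brownianQuad F 0 with hτdef
    set En : ℕ → Set (ℝ × WienerQuad) := fun n ↦ ⋃ k, levelSet F n k with hEndef
    set g : WienerQuad → ℝ≥0∞ := {ω | τ ω ≠ ⊤}.indicator
      (fun ω ↦ ENNReal.ofReal (newtonR (brownianQuad (τ ω).untopA ω))) with hgdef
    set V : ℕ → WienerQuad → ℝ≥0∞ := fun n ↦ {ω | τ ω ≠ ⊤}.indicator
      (fun ω ↦ ENNReal.ofReal (newtonR (brownianQuad (dyadicCeil n (τ ω).untopA) ω))) with hVdef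
    have hEn : ∀ n, loopBase (En n) = ∫⁻ ω, V n ω ∂wienerQuad := fun n ↦ loopBase_iUnion_levelSet hF hne n
    have hmono : Monotone En := iUnion_levelSet_mono F
    have hU : (⋃ n, En n) = {p : ℝ × WienerQuad | LoopHits F p p.1} := iUnion_iUnion_levelSet_eq F
    have hsup : loopBase {p : ℝ × WienerQuad | LoopHits F p p.1} = ⨆ n, loopBase (En n) := by
      rw [← hU]; exact hmono.measure_iUnion
    have hupper : ∀ n, ∫⁻ ω, V n ω ∂wienerQuad ≤ ∫⁻ ω, g ω ∂wienerQuad := fun n ↦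
      lintegral_newtonR_dyadicCeil_le hW hF hFb hδ hFδ n
    -- measurability of `V n` through the level sums
    have hVm : ∀ n, Measurable (V n) := fun n ↦ by
      have : V n = fun ω ↦ ∑' k : ℕ, {ω | ((levelTime n (k - 1) : ℝ≥0) : WithTop ℝ≥0) ≤ τ ω ∧
          τ ω < ((levelTime n k : ℝ≥0) : WithTop ℝ≥0)}.indicator
          (fun ω ↦ newtonFour (brownianQuad (levelTime n k) ω)) ω :=
        funext fun ω ↦ (tsum_level_indicator_eq (F := F) n ω).symm
      rw [this]
      exact Measurable.tsum (measurable_level_indicator hF n)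
    -- pointwise convergence `V n → g`
    have hlim : ∀ ω, Tendsto (fun n ↦ V n ω) atTop (𝓝 (g ω)) := by
      intro ω
      by_cases hT : τ ω ≠ ⊤
      · obtain ⟨T₀, hT₀⟩ := WithTop.ne_top_iff_exists.1 hT
        have huT : (τ ω).untopA = T₀ := by rw [← hT₀]; rfl
        simp only [hVdef, hgdef, indicator_of_mem (show ω ∈ {ω | τ ω ≠ ⊤} from hT), huT]
        have h1 : Tendsto (fun n ↦ brownianQuad (dyadicCeil n T₀) ω) atTop (𝓝 (brownianQuad T₀ ω)) :=
          ((hW.continuous_path ω).tendsto T₀).comp (tendsto_dyadicCeil T₀)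
        have hmem : brownianQuad T₀ ω ∈ F := hW.mem_of_hitFrom_eq_coe hF hT₀.symm
        have hpos : 0 < sqSum (brownianQuad T₀ ω) := (pow_pos hδ 2).trans_le (hFδ _ hmem)
        have h2 : ContinuousAt newtonR (brownianQuad T₀ ω) :=
          (continuous_sqSum.continuousAt).inv₀ hpos.ne'
        exact (ENNReal.continuous_ofReal.tendsto _).comp (h2.tendsto.comp h1)
      · simp only [hVdef, hgdef, indicator_of_notMem (show ω ∉ {ω | τ ω ≠ ⊤} from hT)]
        exact tendsto_const_nhds
    -- Fatou
    have hlower : ∫⁻ ω, g ω ∂wienerQuad ≤ ⨆ n, ∫⁻ ω, V n ω ∂wienerQuad := by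
      calc ∫⁻ ω, g ω ∂wienerQuad = ∫⁻ ω, liminf (fun n ↦ V n ω) atTop ∂wienerQuad :=
            lintegral_congr fun ω ↦ ((hlim ω).liminf_eq).symm
        _ ≤ liminf (fun n ↦ ∫⁻ ω, V n ω ∂wienerQuad) atTop := lintegral_liminf_le hVm
        _ ≤ limsup (fun n ↦ ∫⁻ ω, V n ω ∂wienerQuad) atTop := liminf_le_limsup
        _ ≤ ⨆ n, ∫⁻ ω, V n ω ∂wienerQuad := limsup_le_iSup
    rw [hsup]
    simp only [hEn]
    exact le_antisymm (iSup_le hupper) hlower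

end Literature.Probability.Process

end
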